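import Summits.Parity.GeneralizedHardyLittlewood.Theorems.GoldbachHeathBrownDispersionHeathBrownMorozUniformClassDisplay104Core
import HarnessLib

/-!
# Crux `HeathBrownMorozUniform` (stmt-Parity-19915), line `parent-differencing`: stub `stub_classDisplay104` PROVED
# (the CLASS display (10.4) from the class Type-I square-free sum and `Σ₁^{(d)}`)

Final helper file (`--supports stmt-Parity-19915`) for the registered stub
`stub_classDisplay104 : ClassPairsTypeI → ClassTypeISqfreeSum → ClassSigmaOneCoprime → ClassDisplay104` of the
skeleton `Cruxes/HeathBrownMorozUniform/Lines/parent_differencing.lean` (v3).  The theorem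
`classDisplay104_of_typeISqfreeSum_of_sigmaOneCoprime` below is `ClassTypeISqfreeSum → ClassSigmaOneCoprime →
ClassDisplay104` with the three statement-defs UNFOLDED verbatim (the `Cruxes` module is not importable from
`Theorems/`); the skeleton closes its stub by
`exact fun _ => classDisplay104_of_typeISqfreeSum_of_sigmaOneCoprime` (the extra first hypothesis `ClassPairsTypeI`
of v3 is not needed: the class pair-sum Lemma 3.2 is PROVED in `…ClassDisplay104Pairs`,
`abs_sum_pairs_classCountA_sub_le`).  Contents:

* `eventually_classDisplay104_params` — eventually `X ≥ 4(d+2)²` and `X^τ > d`;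
* `typeI_rhs_mono` — common constants for the class and the parent Type-I sums;
* `classDisplay104_of_inputs` — the class twin of `HeathBrown2001_display_10_4` (∃ `c = 2`, `C`, `X₀`);
* **`classDisplay104_of_typeISqfreeSum_of_sigmaOneCoprime`** — the stub.

**Goldbach is NOT proved by this** — it is one stub of one line on one crux (Heath-Brown–Moroz 2004, Theorem 2)
of the FRONTIER formalisation rung `GoldbachHeathBrownDispersion`.

References: [cite: HeathBrownMoroz2004, Lemma 4.1]; [cite: HeathBrownActa2001, §10 (10.1)–(10.4)].
Tree: `…ClassDisplay104Core` (`classDisplay104_core`), `HeathBrownCubicLeadingA` (`eventually_leadingA_params`),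
`HeathBrownCubicLeadingAPairs` (`exists_typeI_squarefree_sum_le`), `HeathBrownCubicLeadingB`
(`exists_sum_inv_absNorm_idealsLE_le`, `exists_sum_inv_absNorm_window_le`), `HeathBrownCubicApproxUA`
(`eventually_hbTau_pow_mul_log`).
-/

noncomputable section

open Polynomial NumberField Finset Filter Topology

namespace Summit.Parity.GeneralizedHardyLittlewood.Theorems.GoldbachHeathBrownDispersionHeathBrownMorozUniform

open Literature.NumberTheory.Sieve.CubicSieve Literature.NumberTheory.Sieve.CubicPrimes
open Literature.NumberTheory.LFunctions.CubeRootTwoField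


/-! ### Parameters for large `X`, and the class display (10.4) from its two inputs -/

section Final

variable {d a b : ℕ}

/-- **The two extra largeness conditions of the class**: eventually in `X`, `X ≥ 4(d+2)²` (the range of the
landed `class_typeI_A`) and `X^τ > d` (`τ log X ≥ log d + 1`, `τ = (log log X)^{−ϖ}`), so that every
`X^τ`-rough `R ∈ 𝒯r` has `(d, N R) = 1`. [cite: HeathBrownMoroz2004, Lemma 4.1] -/
theorem eventually_classDisplay104_params {ϖ : ℝ} (hϖ0 : 0 < ϖ) (hϖ1 : ϖ ≤ 1) (hd : 0 < d) :
    ∀ᶠ X : ℝ in atTop, 4 * ((d : ℝ) + 2) ^ 2 ≤ X ∧ (d : ℝ) < X ^ hbTau ϖ X := by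
  filter_upwards [eventually_ge_atTop (4 * ((d : ℝ) + 2) ^ 2), eventually_gt_atTop (0 : ℝ),
    eventually_hbTau_pow_mul_log hϖ0 hϖ1 1 (Real.log d + 1) one_pos] with X hXd hX0 hτ
  refine ⟨hXd, ?_⟩
  have h1 : Real.log d + 1 ≤ hbTau ϖ X * Real.log X := by
    have h := hτ.1
    rwa [pow_one] at h
  have hd0 : (0 : ℝ) < d := by exact_mod_cast hd
  rw [Real.rpow_def_of_pos hX0]
  calc (d : ℝ) = Real.exp (Real.log d) := (Real.exp_log hd0).symm
    _ < Real.exp (Real.log d + 1) := Real.exp_lt_exp.mpr (by linarith)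
    _ ≤ Real.exp (Real.log X * hbTau ϖ X) := Real.exp_le_exp.mpr (by rw [mul_comm]; exact h1)

/-- Monotonicity of the Type-I right-hand side `C(X(1 + log X) + (B + X√B + X^{3/2})(log X)^{k+1})` in the
constant `C ≥ 0` and the exponent `k` (for `X ≥ 3`, so that `log X ≥ 1`, and `B ≥ 0`) — used to run the class
and the parent Type-I sums with common constants. [folklore] -/
theorem typeI_rhs_mono {C C' X B : ℝ} {k k' : ℕ} (hC : 0 ≤ C) (hCC' : C ≤ C') (hk : k ≤ k') (hX : 3 ≤ X)
    (hB : 0 ≤ B) :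
    C * (X * (1 + Real.log X) + (B + X * Real.sqrt B + X ^ (3 / 2 : ℝ)) * Real.log X ^ (k + 1)) ≤
      C' * (X * (1 + Real.log X) + (B + X * Real.sqrt B + X ^ (3 / 2 : ℝ)) * Real.log X ^ (k' + 1)) := by
  have hlog1 : 1 ≤ Real.log X := by
    rw [← Real.log_exp 1]
    exact Real.log_le_log (Real.exp_pos 1) (by have := Real.exp_one_lt_d9; linarith)
  have hX0 : 0 ≤ X := by linarith
  have hT : 0 ≤ B + X * Real.sqrt B + X ^ (3 / 2 : ℝ) := by positivity
  have hA : 0 ≤ X * (1 + Real.log X) := by positivity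
  have hpow : Real.log X ^ (k + 1) ≤ Real.log X ^ (k' + 1) := pow_le_pow_right₀ hlog1 (by omega)
  calc C * (X * (1 + Real.log X) + (B + X * Real.sqrt B + X ^ (3 / 2 : ℝ)) * Real.log X ^ (k + 1))
      ≤ C * (X * (1 + Real.log X) + (B + X * Real.sqrt B + X ^ (3 / 2 : ℝ)) * Real.log X ^ (k' + 1)) := by
        gcongr
    _ ≤ C' * (X * (1 + Real.log X) + (B + X * Real.sqrt B + X ^ (3 / 2 : ℝ)) * Real.log X ^ (k' + 1)) :=
        mul_le_mul_of_nonneg_right hCC' (by positivity)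

open scoped Classical in
/-- **The class display (10.4) from its two inputs** (class twin of `HeathBrown2001_display_10_4`): for a
modulus `d ≥ 1` and a class `(a, b)`, GIVEN the class Type-I square-free sum (`hTI`: the `d, a, b` instance
of the skeleton's `ClassTypeISqfreeSum`) and the coprime-restricted singular sum `Σ₁^{(d)}` for `σ₀` (`hSig1`:
the `d, σ₀` instance of `ClassSigmaOneCoprime`), for every `ϖ ∈ (0, 1/5)` there are `c, C, X₀` with
`|U_e(𝒜_cl; 𝐦, c) − (w(d)/d²)σ₀η²X²Σ₃(𝐦, c)| ≤ C·M⁻¹η^{5/2}X²(log X)^c` for `X ≥ X₀`, `η` in (2.1), admissible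
`𝐦`, `c_R` as in (3.3) (here `c = 2`). The parent's Type I (`exists_typeI_squarefree_sum_le`), harmonic sums
(`exists_sum_inv_absNorm_idealsLE_le`, `exists_sum_inv_absNorm_window_le`) and largeness conditions
(`eventually_leadingA_params`) are supplied by the tree. [cite: HeathBrownMoroz2004, Lemma 4.1]
[cite: HeathBrownActa2001, §10 (10.4)] -/
theorem classDisplay104_of_inputs (hd : 0 < d) {kc : ℕ} {Cc : ℝ} (hCc : 0 ≤ Cc)
    (hTI : ∀ X η B : ℝ, 4 * ((d : ℝ) + 2) ^ 2 ≤ X →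
      Real.exp (-Real.log X ^ (1 / 3 : ℝ)) ≤ η → η ≤ 1 → 1 ≤ B → B ≤ X ^ 3 →
        ∑ D ∈ (idealsLE ⌊B⌋₊).filter (fun D => Squarefree (Ideal.absNorm D)),
            |(classCountA X η d a b D : ℝ) -
              (if Nat.Coprime d (Ideal.absNorm D) then
                6 * η ^ 2 * X ^ 2 / Real.pi ^ 2 * zetaTwoCorrection d / (d : ℝ) ^ 2 * rho₂ D /
                  Ideal.absNorm D else 0)| ≤
          Cc * (X * (1 + Real.log X) + (B + X * Real.sqrt B + X ^ (3 / 2 : ℝ)) * Real.log X ^ (kc + 1)))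
    {σ₀ c₁ C₁ : ℝ} (hc₁ : 0 < c₁) (hC₁ : 0 < C₁)
    (hSig1 : ∀ x : ℝ, 1 ≤ x →
      |(∑ J ∈ (idealsLE ⌊x⌋₊).filter
          (fun J => Squarefree (Ideal.absNorm J) ∧ Nat.Coprime d (Ideal.absNorm J)),
          idealMoebius J * Real.log (x / Ideal.absNorm J) * (rho₂ J / Ideal.absNorm J)) -
        Real.pi ^ 2 / 6 * σ₀ * coprimeClassWeight d| ≤ C₁ * Real.exp (-c₁ * Real.sqrt (Real.log x)))
    {ϖ : ℝ} (hϖ0 : 0 < ϖ) (hϖ5 : ϖ < 1 / 5) :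
    ∃ c C X₀ : ℝ, ∀ X η : ℝ, X₀ ≤ X → Real.exp (-Real.log X ^ (1 / 3 : ℝ)) ≤ η → η ≤ 1 →
      ∀ (k : ℕ) (m : Fin k → ℕ), CoreAdmissible (hbTau ϖ X) m →
        ∀ cR : Ideal (𝓞 K) → ℝ, CSupport X (hbTau ϖ X) cR →
          |bilin (classPairs X η d a b) pairIdeal cR (eWeight X (hbTau ϖ X) m) -
              classWeight d / (d : ℝ) ^ 2 * (σ₀ * η ^ 2 * X ^ 2 * sigma3 X (hbTau ϖ X) m cR)| ≤
            C * (∏ i, (m i : ℝ))⁻¹ * η ^ (5 / 2 : ℝ) * X ^ 2 * Real.log X ^ c := by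
  obtain ⟨kp, Cp, hCp, hTIp⟩ := exists_typeI_squarefree_sum_le
  obtain ⟨C₃, hC₃, hharm⟩ := exists_sum_inv_absNorm_idealsLE_le
  obtain ⟨Cw, hCw, hwin⟩ := exists_sum_inv_absNorm_window_le
  -- common Type-I constants for the class and the parent
  set k₂ : ℕ := max kc kp with hk₂
  set C₂ : ℝ := max Cc Cp with hC₂def
  have hC₂ : 0 ≤ C₂ := le_max_of_le_left hCc
  have hd1 : (1 : ℝ) ≤ d := by exact_mod_cast hd
  have hTI' : ∀ X η B : ℝ, 4 * ((d : ℝ) + 2) ^ 2 ≤ X →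
      Real.exp (-Real.log X ^ (1 / 3 : ℝ)) ≤ η → η ≤ 1 → 1 ≤ B → B ≤ X ^ 3 →
        ∑ D ∈ (idealsLE ⌊B⌋₊).filter (fun D => Squarefree (Ideal.absNorm D)),
            |(classCountA X η d a b D : ℝ) -
              (if Nat.Coprime d (Ideal.absNorm D) then
                6 * η ^ 2 * X ^ 2 / Real.pi ^ 2 * zetaTwoCorrection d / (d : ℝ) ^ 2 * rho₂ D /
                  Ideal.absNorm D else 0)| ≤
          C₂ * (X * (1 + Real.log X) + (B + X * Real.sqrt B + X ^ (3 / 2 : ℝ)) * Real.log X ^ (k₂ + 1)) :=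
    fun X η B hX hηlo hη1 hB1 hBX => (hTI X η B hX hηlo hη1 hB1 hBX).trans
      (typeI_rhs_mono hCc (le_max_left _ _) (le_max_left _ _) (by nlinarith) (by linarith))
  have hTIp' : ∀ X η B : ℝ, 3 ≤ X → Real.exp (-Real.log X ^ (1 / 3 : ℝ)) ≤ η → η ≤ 1 → 1 ≤ B → B ≤ X ^ 3 →
      ∑ D ∈ (idealsLE ⌊B⌋₊).filter (fun D => Squarefree (Ideal.absNorm D)),
          |(countA X η D : ℝ) - sizeA X η * rho₂ D / Ideal.absNorm D| ≤
        C₂ * (X * (1 + Real.log X) + (B + X * Real.sqrt B + X ^ (3 / 2 : ℝ)) * Real.log X ^ (k₂ + 1)) :=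
    fun X η B hX hηlo hη1 hB1 hBX => (hTIp X η B hX hηlo hη1 hB1 hBX).trans
      (typeI_rhs_mono hCp (le_max_right _ _) (le_max_right _ _) hX (by linarith))
  have hA₁ : (0 : ℝ) < 96 * (C₂ + 1) := by positivity
  have hA₂ : (0 : ℝ) < 32 * (C₂ + 1) := by positivity
  obtain ⟨X₀, hX₀⟩ := Filter.eventually_atTop.mp
    ((eventually_leadingA_params hϖ0 (by linarith) hc₁ hA₁ hA₂ k₂ (k₂ + 1)).and
      (eventually_classDisplay104_params hϖ0 (by linarith) hd))
  refine ⟨2, 15 * C₃ ^ 2 + 3 * C₃ * (gamma₀ + Cw) + 5 * C₁ * C₃ +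
      20 * C₃ * |classWeight d / (d : ℝ) ^ 2 * σ₀| + 2, X₀,
    fun X η hX hηlo hη1 k m hm cR hc => ?_⟩
  obtain ⟨⟨-, hℓ8, hτ0, hτ8, h10, hhalf, hexp, hT1, hT2⟩, hXd, hdτ⟩ := hX₀ X hX
  have h := classDisplay104_core (a := a) (b := b) hC₁.le hC₂ hC₃.le hCw.le hd hSig1 hTI' hTIp' hharm hwin
    hXd hℓ8 hτ0 hτ8 h10 hdτ hhalf hexp hT1 hT2 hηlo hη1 hm hc
  rw [show Real.log X ^ (2 : ℝ) = Real.log X ^ 2 from Real.rpow_two _]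
  linarith

open scoped Classical in
/-- **Stub `stub_classDisplay104` of the line `parent-differencing` (crux stmt-Parity-19915), PROVED:**
`ClassTypeISqfreeSum → ClassSigmaOneCoprime → ClassDisplay104` with the three statement-defs of the
skeleton `Cruxes/HeathBrownMorozUniform/Lines/parent_differencing.lean` UNFOLDED verbatim (that module is not
importable from `Theorems/`; the skeleton closes its stub by `exact` this theorem). In words: the class Type-I
square-free sum (HBM Lemma 2.4 summed; proved in the skeleton from the landed `class_typeI_A`) and the
coprime-restricted singular sum `Σ₁^{(d)}(x) = (π²/6)σ₀·∏_{p∣d}(p+1)/(p+1−ν_p) + O(e^{−c√log x})` imply the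
CLASS display (10.4): `U_e(𝒜_cl; 𝐦, c) = (w(d)/d²)σ₀η²X²Σ₃(𝐦, c) + O(M⁻¹η^{5/2}X²(log X)^c)` uniformly over
admissible `𝐦` and `c_R` as in (3.3), for every reduced admissible class, every limit `σ₀` of the singular
product and every `ϖ ∈ (0, 1/5)`. Goldbach is NOT proved by this (FRONTIER formalisation rung only).
[cite: HeathBrownMoroz2004, Lemma 4.1] [cite: HeathBrownActa2001, §10 (10.1)–(10.4)] -/
theorem classDisplay104_of_typeISqfreeSum_of_sigmaOneCoprime :
    (∀ d a b : ℕ, 0 < d → a < d → b < d → Nat.Coprime (a ^ 3 + 2 * b ^ 3) d →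
      ∃ (k : ℕ) (C : ℝ), 0 ≤ C ∧ ∀ X η B : ℝ, 4 * ((d : ℝ) + 2) ^ 2 ≤ X →
        Real.exp (-Real.log X ^ (1 / 3 : ℝ)) ≤ η → η ≤ 1 → 1 ≤ B → B ≤ X ^ 3 →
          ∑ D ∈ (idealsLE ⌊B⌋₊).filter (fun D => Squarefree (Ideal.absNorm D)),
              |(classCountA X η d a b D : ℝ) -
                (if Nat.Coprime d (Ideal.absNorm D) then
                  6 * η ^ 2 * X ^ 2 / Real.pi ^ 2 * zetaTwoCorrection d / (d : ℝ) ^ 2 * rho₂ D /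
                    Ideal.absNorm D else 0)| ≤
            C * (X * (1 + Real.log X) + (B + X * Real.sqrt B + X ^ (3 / 2 : ℝ)) * Real.log X ^ (k + 1))) →
    (∀ d : ℕ, 0 < d → ∀ σ₀ : ℝ, Tendsto singularProductPartial atTop (𝓝 σ₀) →
      ∃ c : ℝ, 0 < c ∧ ∃ C : ℝ, 0 < C ∧ ∀ x : ℝ, 1 ≤ x →
        |(∑ J ∈ (idealsLE ⌊x⌋₊).filter
            (fun J => Squarefree (Ideal.absNorm J) ∧ Nat.Coprime d (Ideal.absNorm J)),
            idealMoebius J * Real.log (x / Ideal.absNorm J) * (rho₂ J / Ideal.absNorm J)) -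
          Real.pi ^ 2 / 6 * σ₀ * coprimeClassWeight d| ≤ C * Real.exp (-c * Real.sqrt (Real.log x))) →
    ∀ d a b : ℕ, 0 < d → a < d → b < d → Nat.Coprime (a ^ 3 + 2 * b ^ 3) d →
      ∀ σ₀ : ℝ, Tendsto singularProductPartial atTop (𝓝 σ₀) → ∀ ϖ : ℝ, 0 < ϖ → ϖ < 1 / 5 →
        ∃ c C X₀ : ℝ, ∀ X η : ℝ, X₀ ≤ X → Real.exp (-Real.log X ^ (1 / 3 : ℝ)) ≤ η → η ≤ 1 →
          ∀ (k : ℕ) (m : Fin k → ℕ), CoreAdmissible (hbTau ϖ X) m →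
            ∀ cR : Ideal (𝓞 K) → ℝ, CSupport X (hbTau ϖ X) cR →
              |bilin (classPairs X η d a b) pairIdeal cR (eWeight X (hbTau ϖ X) m) -
                  classWeight d / (d : ℝ) ^ 2 * (σ₀ * η ^ 2 * X ^ 2 * sigma3 X (hbTau ϖ X) m cR)| ≤
                C * (∏ i, (m i : ℝ))⁻¹ * η ^ (5 / 2 : ℝ) * X ^ 2 * Real.log X ^ c := by
  intro hS4a hS3 d a b hd ha hb hadm σ₀ hσ ϖ hϖ0 hϖ5
  obtain ⟨kc, Cc, hCc, hTI⟩ := hS4a d a b hd ha hb hadm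
  obtain ⟨c₁, hc₁, C₁, hC₁, hSig1⟩ := hS3 d hd σ₀ hσ
  exact classDisplay104_of_inputs hd hCc hTI hc₁ hC₁ hSig1 hϖ0 hϖ5

end Final

end Summit.Parity.GeneralizedHardyLittlewood.Theorems.GoldbachHeathBrownDispersionHeathBrownMorozUniform

end
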